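import Summits.Ventures.HodgeRepro2.T6ShadowHost
import Summits.Ventures.HodgeRepro2.T6A2WeilLangeCorner

/-!
# T6ShadowHost2 — the host composite with Lange's identification consumed BY NAME (road A, STATUS l. 11151)

Cell pub-hodge-repro2, Tier 6 (README §10), seat t6-lead (gen 4). The three A1-side binders `e` / `he` / `h4`
of `T6ShadowHost.splitWeilAlgebraic_of_clauses` are here PRODUCED from the cell's ONE Lange display, t6-p2's
`Hyp.LangeBirkenhake1992_Prop1_1_20 Bd` (T6A2HypLange: the `ℚ`-algebra map `⋀ H¹(A, ℚ) → ⨁ₙ Hⁿ(A, ℚ)` of the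
Weil carrier `W := Bd.W` is bijective for every abelian variety, every degree — the print's «any positive
integer n»), through t6-p2's corner lemmas (T6A2WeilLangeCorner): `hL_corner Bd C hD` is the bijectivity at
`B`, `lange4C` / `lange4C_corner_ιMulti` the degree-4 identification `⋀[ℂ]^4 H¹(B, ℂ) ≃ H⁴(B, ℂ)` sending
`ιMulti v` to the four-fold cup, and `exists_eq_sum_cup4C_corner` the degree-4 rationality clause (`ratC` is
`LinearMap.range (TensorProduct.mk ℚ ℂ _ 1)` by `abbrev`, T6A1BaseChange). The ℂ-forms in degrees 2 and 4
are THEOREMS of that chain (T6A2WeilLange), not displays; the page is displayed once (QA-77). Nothing else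
changes: the clauses `hB` / `hnat`, Lemma 1.1.17 `h17`, the transfer shadow `D` with `halg`, and
`Hyp.PeriodN D` are consumed as in T6ShadowHost. No `sorry`; standard axioms.
§8(d): uses an L-value-free non-vanishing device: NO.
-/

noncomputable section

open CategoryTheory
open scoped TensorProduct
open HostAPI.Carriers.AlgebraicGeometry.Motives HostAPI.Carriers.AlgebraicGeometry.HodgeTheory

namespace Summit.Ventures.HodgeRepro2.T6.Host

open Summit.Ventures.HodgeRepro2.T6 Summit.Ventures.HodgeRepro2.T6.A1HostBetti
open Summit.Ventures.HodgeRepro2.T6.A1Dict Summit.Ventures.HodgeRepro2.T6.A1DictRat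
  Summit.Ventures.HodgeRepro2.T6.A1BaseChange Summit.Ventures.HodgeRepro2.T6.WeilLange

variable {K : Type} [Field K] [NumberField K] [NumberField.IsCMField K]
  (coeffC : ∀ (X : SchemeOver ℂ) (k : ℕ), HC X k →ₗ[ℂ] H X k) (Bd : BettiHodgeData ℂ)

/-- The A1-side identification of `H¹` of the corner product from the clauses and the Lange display. -/
def hostIdentW_of_displays (hnat : CoeffNatural coeffC) (hB : BettiClauses coeffC Bd) (C : CornerProduct K)
    (h17 : Lemma1117Q) (hD : Hyp.LangeBirkenhake1992_Prop1_1_20 Bd) :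
    H1Ident K (HC C.B.X 1) (HC C.B.X (2 * 2)) (bcAct C.act) (fun a b c d => cup4C a b c d)
      (· ∈ (ratC : Submodule ℚ (HC C.B.X (2 * 2)))) :=
  hostIdentW_of_clauses coeffC Bd hnat hB C h17 (lange4C Bd (cornerSPVar C) (hL_corner Bd C hD))
    (lange4C_corner_ιMulti Bd C (hL_corner Bd C hD)) (exists_eq_sum_cup4C_corner Bd C (hL_corner Bd C hD))

/-- THE HOST COMPOSITE on the (S4) object with the Lange display consumed by name:
`Hyp.PeriodN D → SplitWeilAlgebraic C` from the clauses, Lemma 1.1.17, Prop. 1.1.20 on the Weil carrier and a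
transfer shadow with algebraic `Alg 2`. -/
theorem splitWeilAlgebraic_of_displays [IsGalois ℚ K] (hnat : CoeffNatural coeffC) (hB : BettiClauses coeffC Bd)
    (C : CornerProduct K) (h17 : Lemma1117Q) (hD : Hyp.LangeBirkenhake1992_Prop1_1_20 Bd)
    (D : TransferShadow C.F)
    (halg : ∀ y ∈ D.Alg 2, (hostIdentW_of_displays coeffC Bd hnat hB C h17 hD).φ₄ (extC K y) ∈
      (coniveau C.B.X (2 * 2) 2).baseChange ℂ)
    (hN : Hyp.PeriodN D) : SplitWeilAlgebraic C :=
  splitWeilAlgebraic_of_clauses coeffC Bd hnat hB C h17 (lange4C Bd (cornerSPVar C) (hL_corner Bd C hD))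
    (lange4C_corner_ιMulti Bd C (hL_corner Bd C hD)) (exists_eq_sum_cup4C_corner Bd C (hL_corner Bd C hD))
    D halg hN

end Summit.Ventures.HodgeRepro2.T6.Host

end
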